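import Literature.IUT.LogVolume.GenuineLogThetaPerImageExactVolume
import Literature.IUT.LogVolume.GenuineLogThetaSlotChoice
import Literature.IUT.LogVolume.PilotSlotResidue
import HarnessLib

/-!
# Reading (U) MINUS reading (P) of the genuine `−|log(Θ)|` IS the (Ind1) slot residue — up to `Σ_{p∈T(I)} log p`
# (genuine Θ-volume inputs; [IUTchIII] Cor. 3.12 / Step (x); [IUTchIV] Thm. 1.10 Step (v); Dupuy–Hilado §4.7, §4.9–4.12)

Proof-only file of the abc-iut cell (R2 S-chain seat abc-iut-s2-p2), part 3 of 3 (parts 1–2: `TensorPacketSlotContent.lean`,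
`GenuineLogThetaPerImageExactVolume.lean`); composes part 2 with abc-iut-c312-3's `ThetaVolumeInput.log_norm_tΘ` and
abc-iut-S8's `PilotData.slotResidue_eq_sum`. TAKES NO SIDE on [IUTchIII] Cor. 3.12 or on which reading print's
`−|log(Θ)|` is. S. Mochizuki, *IUT III* [Mochizuki2012] Cor. 3.12 p. 174 (reading (U), `negLogThetaNonarch`) and proof Step
(x) p. 181 (reading (P), `negLogThetaPerImageNonarch`); *IUT IV* Thm. 1.10 Step (v) p. 27–28 («after symmetrizing with
respect to the choice of "`i† ∈ I`" …»); Dupuy–Hilado [DupuyHilado2025] §4.7, §4.9, §4.11–4.12; cell note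
HOME/plan/c312/STEPV-IND1-NOTE.md.

WHAT IS PROVED, for EVERY genuine Θ-volume input `I : ThetaVolumeInput F₀ K` (any `F₀ ⊆ K`, any section, any ideles):
* `log_norm_tΘ_eq_neg_slotValue` — `log‖t_{Θ,i,v}‖ = −θ_i(v)` with `θ = PilotData.slotValue`;
* `negLogThetaLoc_perImage_two_sided`, `negLogThetaLoc_eq_perImage_of_slotConstant` — prime by prime;
* **`perImage_add_slotResidue_sub_le_negLogThetaNonarch`** and **`negLogThetaNonarch_le_perImage_add_slotResidue`**:
  `negLogThetaPerImageNonarch I + slotResidue(P_Θ; T(I)) − Σ_{p∈T(I)} log p ≤ negLogThetaNonarch I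
     ≤ negLogThetaPerImageNonarch I + slotResidue(P_Θ; T(I)) + Σ_{p∈T(I)} log p`;
* **`negLogThetaNonarch_eq_perImage_of_slotConstant`** — EQUALITY at slot-constant inputs (one place over each support
  prime, e.g. `F₀ = ℚ`): there [IUTchIV] Step (v)'s symmetrisation is exact;
* `hullEstimatePerImageOf_of_hullEstimateOf_residue` (`HullEstimateOf δ → HullEstimatePerImageOf (δ − slotResidue + Σ log p)`),
  `hullEstimateOf_of_hullEstimatePerImageOf_residue` (`HullEstimatePerImageOf δ → HullEstimateOf (δ + slotResidue + Σ log p)`).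
READING (for the planners; nothing asserted about print). The ENTIRE difference between the cell's CLOSED per-image line
(ii′-P) (`stub_hullVolumePerImage`, p425589) and the OPEN union line (ii′-U) (`hvol` / `hreg` of `Conditional/AbcOfS*`) is
the (Ind1) slot residue of the pilot data, to within `Σ_{p∈T(I)} log p` (`≤ 2·d_mod·(log-diff + log-cond) + log(30·l)` at a
datum, abc-iut-S3): closing (ii′-U) at a datum `T` with constant `δ` is the same as proving (ii′-P) at `T` with the constant
`δ − slotResidue(T)` (± that sum), i.e. improving the per-image estimate at `T` by exactly the residue; conversely every
per-image estimate yields the union estimate plus the residue (abc-iut-S8's necessity `slotResidue ≤ δ` and abc-iut-c312-d1's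
all-regime sufficiency are the two ends). [cite: Mochizuki2012, IUTchIII Cor. 3.12 p. 174; proof Step (x) p. 181]
[cite: Mochizuki2012, IUTchIV Thm. 1.10 Step (v) p. 27–28] [cite: DupuyHilado2025, §4.7, §4.9, §4.11, §4.12]
[claim: Mochizuki2012, status: disputed] for every IUT quotation. PROOF-ONLY: no definitions; typed ≠ proved.
-/

noncomputable section

open Set Module NumberField IsDedekindDomain
open scoped Pointwise TensorProduct

namespace Literature.IUT.LogVolume

/-! ## Input level: the genuine `−|log(Θ)|` of a Θ-volume input in the two readings -/

namespace ThetaVolumeInput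

variable {F₀ : Type} [Field F₀] [NumberField F₀] {K : Type} [Field K] [NumberField K] [Algebra F₀ K]
variable (I : ThetaVolumeInput F₀ K)

/-- The idele norms of a genuine input ARE the slot values: `log‖t_{Θ,i,v}‖ = −θ_i(v)`,
`θ_i(v) = P_{Θ,i}(v)·ln N(v)/n_v = PilotData.slotValue` (abc-iut-c312-3 `log_norm_tΘ`). [cite: DupuyHilado2025, §3.4, §3.9] -/
theorem log_norm_tΘ_eq_neg_slotValue (p : ℕ) [hp : Fact p.Prime] (i : Fin I.lstar) (v : placesOver F₀ p) :
    Real.log ‖(I.tΘ p hp.out i v : (I.σ.localFieldFamily p hp.out).k v)‖ = -I.X.slotValue i v.1 := by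
  rw [I.log_norm_tΘ p i v, PilotData.slotValue]
  ring

/-- **At a prime: reading (U) = reading (P) + the `p`-part of the slot residue, up to `± log p`.**
[cite: Mochizuki2012, IUTchIII Cor. 3.12 p. 174; proof Step (x) p. 181] [cite: DupuyHilado2025, Def. 3.6.3, §4.7, §4.12] -/
theorem negLogThetaLoc_perImage_two_sided (p : ℕ) [hp : Fact p.Prime] :
    I.negLogThetaPerImageLoc p +
        (1 / (I.X.lstar : ℝ)) * ∑ i : Fin I.X.lstar, ∑ e : Fin ((i : ℕ) + 1 + 1) → placesOver F₀ p,
          (I.X.slotValue i (e (Fin.last _)).1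
            - Finset.univ.inf' Finset.univ_nonempty (fun k => I.X.slotValue i (e k).1)) *
            ∏ k, weight F₀ (e k).1 - Real.log p ≤ I.negLogThetaLoc p ∧
    I.negLogThetaLoc p ≤ I.negLogThetaPerImageLoc p +
        (1 / (I.X.lstar : ℝ)) * ∑ i : Fin I.X.lstar, ∑ e : Fin ((i : ℕ) + 1 + 1) → placesOver F₀ p,
          (I.X.slotValue i (e (Fin.last _)).1
            - Finset.univ.inf' Finset.univ_nonempty (fun k => I.X.slotValue i (e k).1)) *
            ∏ k, weight F₀ (e k).1 + Real.log p := by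
  have hl : 0 < I.X.lstar := by have := I.X.two_le_lstar; omega
  have h := realPrimePacketWith_negLogThetaAt_perImage_two_sided p (I.σ.localFieldFamily p hp.out)
    (mScale p (I.σ.localFieldFamily p hp.out)) (mScale_ne_zero p (I.σ.localFieldFamily p hp.out))
    (mScale_perm p (I.σ.localFieldFamily p hp.out)) hl (I.tΘ p hp.out) (fun i v => I.X.slotValue i v.1)
    (fun i v => I.log_norm_tΘ_eq_neg_slotValue p i v)
  rw [I.negLogThetaLoc_of_prime hp.out, I.negLogThetaPerImageLoc_of_prime hp.out]
  exact h

/-- At a prime where the pilot data are slot-constant the two readings agree. [cite: Mochizuki2012, IUTchIV Thm. 1.10 Step (v) p. 28] -/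
theorem negLogThetaLoc_eq_perImage_of_slotConstant (p : ℕ) [hp : Fact p.Prime]
    (hconst : ∀ (i : Fin I.X.lstar) (v w : placesOver F₀ p), I.X.slotValue i v.1 = I.X.slotValue i w.1) :
    I.negLogThetaLoc p = I.negLogThetaPerImageLoc p := by
  have h := realPrimePacketWith_negLogThetaAt_eq_perImage_of_const p (I.σ.localFieldFamily p hp.out)
    (mScale p (I.σ.localFieldFamily p hp.out)) (mScale_ne_zero p (I.σ.localFieldFamily p hp.out))
    (mScale_perm p (I.σ.localFieldFamily p hp.out)) (I.tΘ p hp.out) (fun i v => I.X.slotValue i v.1)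
    (fun i v => I.log_norm_tΘ_eq_neg_slotValue p i v) hconst
  rw [I.negLogThetaLoc_of_prime hp.out, I.negLogThetaPerImageLoc_of_prime hp.out]
  exact h

/-- **READING (U) = READING (P) + THE (Ind1) SLOT RESIDUE, up to `Σ_{p∈T(I)} log p` — lower half**:
`negLogThetaPerImageNonarch I + slotResidue(P_Θ; T(I)) − Σ_{p∈T(I)} log p ≤ negLogThetaNonarch I`.
[cite: Mochizuki2012, IUTchIII Cor. 3.12 p. 174; proof Step (x) p. 181] [cite: Mochizuki2012, IUTchIV Thm. 1.10 Step (v) p. 27–28]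
[cite: DupuyHilado2025, §4.7, §4.11, §4.12] -/
theorem perImage_add_slotResidue_sub_le_negLogThetaNonarch :
    I.negLogThetaPerImageNonarch + I.X.slotResidue I.supportPrimes - ∑ p ∈ I.supportPrimes, Real.log p ≤
      I.negLogThetaNonarch := by
  unfold negLogThetaNonarch negLogThetaPerImageNonarch
  rw [PilotData.slotResidue_eq_sum, ← Finset.sum_add_distrib, ← Finset.sum_sub_distrib]
  refine Finset.sum_le_sum fun p hp => ?_
  haveI : Fact p.Prime := ⟨I.prime_of_mem_supportPrimes hp⟩
  exact (I.negLogThetaLoc_perImage_two_sided p).1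

/-- **… upper half**: `negLogThetaNonarch I ≤ negLogThetaPerImageNonarch I + slotResidue(P_Θ; T(I)) + Σ_{p∈T(I)} log p`.
[cite: Mochizuki2012, IUTchIII Cor. 3.12 p. 174; proof Step (x) p. 181] [cite: Mochizuki2012, IUTchIV Thm. 1.10 Step (v) p. 27–28]
[cite: DupuyHilado2025, §4.7, §4.11, §4.12] -/
theorem negLogThetaNonarch_le_perImage_add_slotResidue :
    I.negLogThetaNonarch ≤
      I.negLogThetaPerImageNonarch + I.X.slotResidue I.supportPrimes + ∑ p ∈ I.supportPrimes, Real.log p := by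
  unfold negLogThetaNonarch negLogThetaPerImageNonarch
  rw [PilotData.slotResidue_eq_sum, ← Finset.sum_add_distrib, ← Finset.sum_add_distrib]
  refine Finset.sum_le_sum fun p hp => ?_
  haveI : Fact p.Prime := ⟨I.prime_of_mem_supportPrimes hp⟩
  exact (I.negLogThetaLoc_perImage_two_sided p).2

/-- **The two readings agree at SLOT-CONSTANT inputs** (`θ_i` constant on `V(F₀)_p` for every support prime, e.g.
one place over each `p`, `F₀ = ℚ`): `negLogThetaNonarch I = negLogThetaPerImageNonarch I` — [IUTchIV] Step (v)'s
symmetrisation is exact there. [cite: Mochizuki2012, IUTchIV Thm. 1.10 Step (v) p. 28] [cite: DupuyHilado2025, §4.7] -/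
theorem negLogThetaNonarch_eq_perImage_of_slotConstant
    (hconst : ∀ p ∈ I.supportPrimes, ∀ (i : Fin I.X.lstar) (v w : placesOver F₀ p),
      I.X.slotValue i v.1 = I.X.slotValue i w.1) :
    I.negLogThetaNonarch = I.negLogThetaPerImageNonarch := by
  unfold negLogThetaNonarch negLogThetaPerImageNonarch
  refine Finset.sum_congr rfl fun p hp => ?_
  haveI : Fact p.Prime := ⟨I.prime_of_mem_supportPrimes hp⟩
  exact I.negLogThetaLoc_eq_perImage_of_slotConstant p (hconst p hp)

/-- **From (U) to (P)**: `HullEstimateOf I δ → HullEstimatePerImageOf I (δ − slotResidue + Σ_{p∈T(I)} log p)` — an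
estimate for the hull of the UNION is an estimate for the per-image hull with the constant LOWERED by the residue
(up to the rounding sum). [cite: Mochizuki2012, IUTchIV Thm. 1.10 Steps (v)–(viii) p. 27–31] -/
theorem hullEstimatePerImageOf_of_hullEstimateOf_residue {δ : ℝ} (h : I.HullEstimateOf δ) :
    I.HullEstimatePerImageOf (δ - I.X.slotResidue I.supportPrimes + ∑ p ∈ I.supportPrimes, Real.log p) := by
  unfold HullEstimateOf at h
  unfold HullEstimatePerImageOf
  have h1 := I.perImage_add_slotResidue_sub_le_negLogThetaNonarch
  linarith

/-- **From (P) to (U)**: `HullEstimatePerImageOf I δ → HullEstimateOf I (δ + slotResidue + Σ_{p∈T(I)} log p)` — the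
union line costs EXACTLY the slot residue on top of the per-image line (up to the rounding sum).
[cite: Mochizuki2012, IUTchIV Thm. 1.10 Steps (v)–(viii) p. 27–31] -/
theorem hullEstimateOf_of_hullEstimatePerImageOf_residue {δ : ℝ} (h : I.HullEstimatePerImageOf δ) :
    I.HullEstimateOf (δ + I.X.slotResidue I.supportPrimes + ∑ p ∈ I.supportPrimes, Real.log p) := by
  unfold HullEstimatePerImageOf at h
  unfold HullEstimateOf
  have h1 := I.negLogThetaNonarch_le_perImage_add_slotResidue
  linarith

/-! ## Refinement: the rounding term lives on the NON-slot-constant primes only -/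

/-- At a prime where the pilot data are slot-constant, the `p`-part of the slot residue vanishes.
[cite: DupuyHilado2025, §4.7] [cite: Mochizuki2012, IUTchIV Thm. 1.10 Step (v) p. 28] -/
theorem slotResidue_term_eq_zero_of_slotConstant (p : ℕ)
    (hconst : ∀ (i : Fin I.X.lstar) (v w : placesOver F₀ p), I.X.slotValue i v.1 = I.X.slotValue i w.1) :
    (1 / (I.X.lstar : ℝ)) * ∑ i : Fin I.X.lstar, ∑ e : Fin ((i : ℕ) + 1 + 1) → placesOver F₀ p,
        (I.X.slotValue i (e (Fin.last _)).1
          - Finset.univ.inf' Finset.univ_nonempty (fun k => I.X.slotValue i (e k).1)) *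
          ∏ k, weight F₀ (e k).1 = 0 := by
  rw [Finset.sum_eq_zero fun i _ => ?_, mul_zero]
  refine Finset.sum_eq_zero fun e _ => ?_
  have hc : Finset.univ.inf' Finset.univ_nonempty (fun k => I.X.slotValue i (e k).1) =
      I.X.slotValue i (e (Fin.last _)).1 := by
    refine le_antisymm (Finset.inf'_le _ (Finset.mem_univ _)) ?_
    exact Finset.le_inf' _ _ fun k _ => (hconst i (e (Fin.last _)) (e k)).le
  rw [hc, sub_self, zero_mul]

/-- **Two-sided with the rounding term on the MIXED primes only**: for any set `C ⊆ T(I)` of support primes at which the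
pilot data are slot-constant,
`negLogThetaPerImageNonarch I + slotResidue − Σ_{p∈T(I)∖C} log p ≤ negLogThetaNonarch I ≤ negLogThetaPerImageNonarch I + slotResidue + Σ_{p∈T(I)∖C} log p`
(at the primes of `C` the two readings agree exactly and the residue has no `p`-part). With `C = T(I)` (e.g. `F₀ = ℚ`) this is the
equality `negLogThetaNonarch_eq_perImage_of_slotConstant`. [cite: Mochizuki2012, IUTchIII Cor. 3.12 p. 174; proof Step (x) p. 181]
[cite: Mochizuki2012, IUTchIV Thm. 1.10 Step (v) p. 27–28] [cite: DupuyHilado2025, §4.7, §4.11, §4.12] -/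
theorem negLogThetaNonarch_perImage_two_sided_of_slotConstantOn (C : Finset ℕ) (hC : C ⊆ I.supportPrimes)
    (hconst : ∀ p ∈ C, ∀ (i : Fin I.X.lstar) (v w : placesOver F₀ p), I.X.slotValue i v.1 = I.X.slotValue i w.1) :
    I.negLogThetaPerImageNonarch + I.X.slotResidue I.supportPrimes - ∑ p ∈ I.supportPrimes \ C, Real.log p ≤
        I.negLogThetaNonarch ∧
      I.negLogThetaNonarch ≤
        I.negLogThetaPerImageNonarch + I.X.slotResidue I.supportPrimes + ∑ p ∈ I.supportPrimes \ C, Real.log p := by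
  classical
  -- split every sum over `T(I)` into the parts over `T(I) ∖ C` and over `C`
  have hU : I.negLogThetaNonarch =
      ∑ p ∈ I.supportPrimes \ C, I.negLogThetaLoc p + ∑ p ∈ C, I.negLogThetaLoc p := by
    unfold negLogThetaNonarch; rw [Finset.sum_sdiff hC]
  have hP : I.negLogThetaPerImageNonarch =
      ∑ p ∈ I.supportPrimes \ C, I.negLogThetaPerImageLoc p + ∑ p ∈ C, I.negLogThetaPerImageLoc p := by
    unfold negLogThetaPerImageNonarch; rw [Finset.sum_sdiff hC]
  have hR : I.X.slotResidue I.supportPrimes =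
      ∑ p ∈ I.supportPrimes \ C, (1 / (I.X.lstar : ℝ)) * ∑ i : Fin I.X.lstar,
          ∑ e : Fin ((i : ℕ) + 1 + 1) → placesOver F₀ p,
            (I.X.slotValue i (e (Fin.last _)).1
              - Finset.univ.inf' Finset.univ_nonempty (fun k => I.X.slotValue i (e k).1)) *
              ∏ k, weight F₀ (e k).1 +
        ∑ p ∈ C, (1 / (I.X.lstar : ℝ)) * ∑ i : Fin I.X.lstar,
          ∑ e : Fin ((i : ℕ) + 1 + 1) → placesOver F₀ p,
            (I.X.slotValue i (e (Fin.last _)).1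
              - Finset.univ.inf' Finset.univ_nonempty (fun k => I.X.slotValue i (e k).1)) *
              ∏ k, weight F₀ (e k).1 := by
    rw [PilotData.slotResidue_eq_sum, Finset.sum_sdiff hC]
  -- on `C`: the readings agree and the residue has no `p`-part
  have hCU : ∑ p ∈ C, I.negLogThetaLoc p = ∑ p ∈ C, I.negLogThetaPerImageLoc p := by
    refine Finset.sum_congr rfl fun p hp => ?_
    haveI : Fact p.Prime := ⟨I.prime_of_mem_supportPrimes (hC hp)⟩
    exact I.negLogThetaLoc_eq_perImage_of_slotConstant p (hconst p hp)
  have hCR : ∑ p ∈ C, (1 / (I.X.lstar : ℝ)) * ∑ i : Fin I.X.lstar,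
      ∑ e : Fin ((i : ℕ) + 1 + 1) → placesOver F₀ p,
        (I.X.slotValue i (e (Fin.last _)).1
          - Finset.univ.inf' Finset.univ_nonempty (fun k => I.X.slotValue i (e k).1)) *
          ∏ k, weight F₀ (e k).1 = 0 :=
    Finset.sum_eq_zero fun p hp => I.slotResidue_term_eq_zero_of_slotConstant p (hconst p hp)
  -- off `C`: the per-prime two-sided bound
  have hlo : ∑ p ∈ I.supportPrimes \ C, (I.negLogThetaPerImageLoc p +
      (1 / (I.X.lstar : ℝ)) * ∑ i : Fin I.X.lstar, ∑ e : Fin ((i : ℕ) + 1 + 1) → placesOver F₀ p,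
        (I.X.slotValue i (e (Fin.last _)).1
          - Finset.univ.inf' Finset.univ_nonempty (fun k => I.X.slotValue i (e k).1)) *
          ∏ k, weight F₀ (e k).1 - Real.log p) ≤
      ∑ p ∈ I.supportPrimes \ C, I.negLogThetaLoc p := by
    refine Finset.sum_le_sum fun p hp => ?_
    haveI : Fact p.Prime := ⟨I.prime_of_mem_supportPrimes (Finset.mem_sdiff.mp hp).1⟩
    exact (I.negLogThetaLoc_perImage_two_sided p).1
  have hhi : ∑ p ∈ I.supportPrimes \ C, I.negLogThetaLoc p ≤
      ∑ p ∈ I.supportPrimes \ C, (I.negLogThetaPerImageLoc p +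
      (1 / (I.X.lstar : ℝ)) * ∑ i : Fin I.X.lstar, ∑ e : Fin ((i : ℕ) + 1 + 1) → placesOver F₀ p,
        (I.X.slotValue i (e (Fin.last _)).1
          - Finset.univ.inf' Finset.univ_nonempty (fun k => I.X.slotValue i (e k).1)) *
          ∏ k, weight F₀ (e k).1 + Real.log p) := by
    refine Finset.sum_le_sum fun p hp => ?_
    haveI : Fact p.Prime := ⟨I.prime_of_mem_supportPrimes (Finset.mem_sdiff.mp hp).1⟩
    exact (I.negLogThetaLoc_perImage_two_sided p).2
  rw [Finset.sum_sub_distrib, Finset.sum_add_distrib] at hlo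
  rw [Finset.sum_add_distrib, Finset.sum_add_distrib] at hhi
  rw [hU, hP, hR, hCU, hCR]
  constructor <;> linarith

/-- `HullEstimateOf δ → HullEstimatePerImageOf (δ − slotResidue + Σ_{p∈T(I)∖C} log p)` for any set `C` of slot-constant support
primes. [cite: Mochizuki2012, IUTchIV Thm. 1.10 Steps (v)–(viii) p. 27–31] -/
theorem hullEstimatePerImageOf_of_hullEstimateOf_residue_of_slotConstantOn (C : Finset ℕ) (hC : C ⊆ I.supportPrimes)
    (hconst : ∀ p ∈ C, ∀ (i : Fin I.X.lstar) (v w : placesOver F₀ p), I.X.slotValue i v.1 = I.X.slotValue i w.1)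
    {δ : ℝ} (h : I.HullEstimateOf δ) :
    I.HullEstimatePerImageOf (δ - I.X.slotResidue I.supportPrimes + ∑ p ∈ I.supportPrimes \ C, Real.log p) := by
  unfold HullEstimateOf at h
  unfold HullEstimatePerImageOf
  have h1 := (I.negLogThetaNonarch_perImage_two_sided_of_slotConstantOn C hC hconst).1
  linarith

/-- `HullEstimatePerImageOf δ → HullEstimateOf (δ + slotResidue + Σ_{p∈T(I)∖C} log p)` for any set `C` of slot-constant support
primes. [cite: Mochizuki2012, IUTchIV Thm. 1.10 Steps (v)–(viii) p. 27–31] -/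
theorem hullEstimateOf_of_hullEstimatePerImageOf_residue_of_slotConstantOn (C : Finset ℕ) (hC : C ⊆ I.supportPrimes)
    (hconst : ∀ p ∈ C, ∀ (i : Fin I.X.lstar) (v w : placesOver F₀ p), I.X.slotValue i v.1 = I.X.slotValue i w.1)
    {δ : ℝ} (h : I.HullEstimatePerImageOf δ) :
    I.HullEstimateOf (δ + I.X.slotResidue I.supportPrimes + ∑ p ∈ I.supportPrimes \ C, Real.log p) := by
  unfold HullEstimatePerImageOf at h
  unfold HullEstimateOf
  have h1 := (I.negLogThetaNonarch_perImage_two_sided_of_slotConstantOn C hC hconst).2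
  linarith

end ThetaVolumeInput

end Literature.IUT.LogVolume

end
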